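import Literature.MathematicalPhysics.QuantumFieldTheory.Balaban1983to89.BalabanAdmissibleClassParams
import HarnessLib

/-!
# `Balaban1983to89.BalabanLocalisedClass` — the LOCALISED (quasi-local, analytic) refinement of Bałaban's class of effective
# densities: EXACT small-field representation, complex-analytic local activities with their bound ON THE COMPLEX TUBE, analytic and
# quasi-local background, and the TOWER clause «`ρ_j` is the renormalization transform of `ρ_{j+1}`» on the d = 3 height lattices

Work item `defn-BalabanLocalisedClass` (kind definition; requested by `planner-ym-r3-idea-1-g11-0` for the organ
`Summit.QuantumFields.YangMills.Theses.BackwardLiouvilleRigidity.OneStepBackwardContraction`, stmt-QuantumFields-27939, route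
`BackwardLiouvilleRigidity`; repair «R1» of the refutation dossier `Cruxes/FluctuationComparisonRegPrIntL/Lines/organ_twisted_fibre.md`).
The request: «LOCALISED (quasi-local analytic) version of `BalabanUVClass.Mem/MemAtHeight`: a predicate `LocMem av prm r` whose witness
carries, BEYOND the sandwich clauses of `BalabanUVClass.Witness`, (a) the effective action as a FUNCTION with `r V = χ_k(V)·exp(eff V) +
lf V` on the all-small set and `eff V = −β·A(bg V) + Σ_X act X (bg V) + cst` EXACTLY (no ±slack), (b) quasi-locality + analyticity of
`V ↦ bg V` and of each `act X` in the complexified small-field domain with the bounds `|act X| ≤ wt X·e^{−κ𝓛(X)}` holding on that complex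
domain, (c) a TRAJECTORY version `LocMemTower F ℰ prm ρ`: `ρ_j` = one renormalization transformation applied to `ρ_{j+1}` … EXACTLY (the
run structure). Purpose: re-type the organ so that tilted fibre laws are excluded».

## What this file is

**§1 (generic `Setup` vocabulary; any `Params`, level `k`, gauge group `G`, averaging family `av`).**
* `LocClassParams ⊇ ClassParams`: four more explicit reals — `δanU`, `δanV`, the radii of the COMPLEX TUBES around regular fine
  configurations (activities holomorphic there; [Balaban1987RG1] (1.13) p.262 `𝐔 = U′U`, `U′ = exp iξA′`, `|A′| < α₁`) and around an
  all-small datum (background holomorphic there; [Balaban1985Variational] (172) p.305 `|V′ − 1| < C₁ε₁`); `Cql`, `κql`, prefactor and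
  rate of the QUASI-LOCALITY of the background ([Balaban1985Variational] Prop. 9 (190) p.309: `O(1)·…·exp(−⅛δ₀d(y, y′))`).
* `CplxModel G 𝔄`: a COMPLEX MODEL of the abstract gauge-group interface — a faithful monoid embedding `ι : G →* 𝔄` into a normed
  ℂ-algebra with `‖ι g − 1‖ = dist1 g` and `‖ι g‖ ≤ 1` (print: «G is a Lie subgroup of a group of complex unitary matrices, for example
  G ⊂ U(N)», «we also consider the complexified group Gᶜ. Elements of this group are defined as matrices of the form U = U′U»,
  [Balaban1987RG1] p.252; `Setup` DIVERGENCE F4 leaves `Gᶜ` as a further type parameter — here it is `𝔄 ⊇ ι(G)`).  INHABITED for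
  `SU(n) ⊂ M_n(ℂ)` with the L²-operator norm by the tree's fundamental representation (`CplxModel.specialUnitary`; `dist1` of
  `UnitaryModel` is that norm by `rfl`).  Complex configurations are `PBond P j → 𝔄`; `cplxTube M δ U` is the polydisc
  `‖W_b − ι(U_b)‖ < δ` around a real configuration (a READING of conditions (i)–(iii) (1.11)–(1.14) p.262, which print states through
  `U′ = exp iξA′`, `|A′| < α₁` and plaquette bounds; the two neighbourhood systems of `ι(G)^{bonds}` are equivalent up to constants).
* `LocWitness av prm M r` EXTENDS `BalabanUVClass.Witness av prm.toClassParams r` (every sandwich clause and datum is kept verbatim) by: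
  (a) `exact` — ON THE ALL-SMALL SET THE REPRESENTATION IS AN IDENTITY, `r V = exp(−β·A(bg V) + Σ_X act X (bg V) + cst) + lf V`
      ([Balaban1987RG1] (0.22) p.256 «A_k(g_k, V) = A_k(g_k, U_k(V)) = −(1/g_k²)A(U_k(V)) + E_k(U_k(V))», (0.24) p.257 «E^{(j)}(U) =
      Σ_{X∈D_j} E^{(j)}(X, U)», Theorem 1 p.259 «the effective actions for small fields are given by the formulas (0.22)–(0.24)»; for the
      full densities the `Z = ∅` term of [Balaban1988Convergent] (2.18) / [Balaban1989LargeFieldI] (0.2) p.176 «A density ρ after some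
      number of steps is represented in the form ρ(V) = Σ_Z ρ(Z, V) where the sum is over large field regions Z», the `Z ≠ ∅` terms
      being `lf ≥ 0`).  The sandwich (41)/(47) of [Balaban1985UV3] is then a COROLLARY for `0 ≤ slack` (`lower_of_exact`,
      `upper_of_exact`).
  (b1) `actC` — a COMPLEX EXTENSION of every activity to complex configurations, HOLOMORPHIC (`AnalyticOnNhd ℂ`) on the tube of radius
      `δanU` around every REGULAR real fine configuration (in particular around the background of every all-small datum,
      `Witness.bg_regular`), agreeing with `act` at regular real configurations, LOCAL (depends on the configuration restricted to
      `supp X`) and obeying THE SAME BOUND `‖actC X W‖ ≤ wt X·e^{−κ𝓛(X)}` ON THE COMPLEX TUBE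
      ([Balaban1987RG1] p.263 «We assume that the function E^{(j)}(X, g_{j−1}, 𝐔, 𝐉) is defined and analytic on the space Uᶜ_j(X, α₀, α₁)
      … It depends on the configurations restricted to X … There exists a constant E₀ such that |E^{(j)}(X, g_{j−1}, 𝐔, 𝐉)| ≤ E₀exp(−κd_j(X))
      (1.18) … for all configurations (𝐔, 𝐉) ∈ Uᶜ_j(X, α₀, α₁)», and p.263 «In particular the minimal configurations U_j … satisfy the above
      conditions»; [Balaban1985UV3] p.263 «The third property is the analyticity with respect to U₁»).
  (b2) `bg_analytic` — THE BACKGROUND IS LOCALLY THE RESTRICTION OF A HOLOMORPHIC MAP: around every all-small `V₀` a map `Φ`, holomorphic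
      on the tube of radius `δanV` around `ι∘V₀`, with `Φ(ι∘V) = ι∘(bg V)` for the real all-small `V` in that tube ([Balaban1985Variational]
      Prop. 9 p.309 «The minimal configuration U_k(V) = U_k(V′V₀) in the axial gauge has an extension to an analytic function of Gᶜ-valued
      small configurations V′ on 𝔅_k», p.307 «for V′ with values in G it coincides with the minimal configuration constructed in the
      previous sections»).
  (b3) `wilson_bg_quasilocal`, `act_bg_quasilocal` — GAUGE-INVARIANT QUASI-LOCALITY of the composite maps `V ↦ Re tr ∂(bg V)(p)` and
      `V ↦ act X (bg V)`: two all-small data agreeing on every level-`k` bond within `R` lattice steps of the block above `p` (of the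
      footprint of `X`) give values within `Cql·e^{−κql·R}` times the natural size (`δreg²` for a plaquette trace of the regular
      background, `wt X e^{−κ𝓛(X)}` for an activity) — a READING (integrated, gauge-invariant form) of the exponential decay (190) of the functional derivative `(δ/δB(y′))𝓗(B, x)` of the background in the datum
      ([Balaban1985Variational] Prop. 9 (190) p.308–309) combined with the Lipschitz bound that analyticity + (1.18) give on the tube.
* `LocMem av prm M r := Nonempty (LocWitness av prm M r)`; `LocMem → Mem` (`LocMem.mem`).
* NON-VACUITY (`LocWitness.initial`): at level `k = 0` Bałaban's INITIAL DENSITY `ρ₀ = exp(−β·A(U))` ([Balaban1985UV3] (1) p.256) is a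
  localised-class member with NO activities, background `= id`, `lf = 0` — every clause is then an identity or elementary.

**§2 (admissible schedules).**  `LocAdmissibleClassParams F γ b₀ p₀ prm` = `AdmissibleClassParams` on the `ClassParams` part + the printed
height-dependence of the four new reals (`δanV_j ≥ c₀θ(j)`: the analyticity radius `C₁ε₁` of (172) is proportional to the regularity
`ε₁` of the datum, i.e. to the window; `0 < δanU_j`: like `δreg_j`, only positivity is expressible on `prm j` alone (READING below);
`κql_j ≥ κ₀ > 0`, `Cql_j ≤ C₀`: (190) has absolute `δ₀/8` and `O(1)`); the printed schedule `printedLocSchedule` is admissible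
(`printedLocSchedule_admissible`).

**§3 (the d = 3 height lattices of a `T3Family`; mirrors `BalabanUVClass` §2).**  `LocMemOfRun F ℰ M hK prm r`, `LocMemAtHeight F ℰ M j prm
r` (the height-`j` density read on run `K ≥ j`), and (c) THE TOWER CLAUSE `IsDescentRT F ℰ j ρup ρdn`: `ρdn·dU_j` is the push-forward of
`ρup·dU_{j+1}` under the one-step descent `descend F ℰ j` — `∫ ρdn·f dU_j = ∫ ρup·(f ∘ descend) dU_{j+1}` for bounded measurable `f`, the
`Setup.IsRT` reading (DIVERGENCE F7: no pointwise δ-functions) of [Balaban1985UV3] (2) «ρ_{k+1} = Tρ_k» / [Balaban1985Averaging] (10)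
`(Tρ)(V) = ∫ dU δ(ŪV⁻¹) ρ(U)` / [Balaban1987RG1] (0.13) «(Tρ)(V) = ∫ dU t(V, U) ρ(U)» between consecutive HEIGHT lattices (`descend` =
one (0.4) averaging + the level identification, `T3NestedUnitLaws`).  PROVED: `isDescentRT_of_map_withDensity` (the organ's pair of
hypotheses «μ_j = map (descend) μ_{j+1}», «μ_j = dU_j.withDensity ρ_j» implies it) and the converse `IsDescentRT.map_withDensity`
(for integrable densities), `IsDescentRT.integral_eq` (total mass), `IsDescentRT.setIntegral_eq`, `IsDescentRT.ae_eq` («two members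
over the same run differ only in the initial density»: the lower density is determined a.e. by the upper one).  `LocMemTower F ℰ M j₀
prm ρ := ∀ j ≥ j₀, LocMemAtHeight … (prm j) (ρ j) ∧ IsDescentRT F ℰ j (ρ (j+1)) (ρ j)` and the finite-run form `LocMemTowerOfRun F ℰ M
j₀ K prm ρ` (ONE depth `K` for all heights `j₀ ≤ j ≤ K`).  §3b (asked for by the requester as a SEPARATE schema): `IsSmallFieldRT F ℰ j
δup δdn effup effdn` = the small-field renormalization step [Balaban1987RG1] (0.19) p.255 between consecutive EFFECTIVE ACTIONS, in the
push-forward reading and on the windows — `∃ N > 0`, `∫ e^{effdn}·f dU_j = N·∫ χ_{δup}·e^{effup}·(f ∘ descend) dU_{j+1}` for bounded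
measurable `f` supported in `{PlaqSmall δdn}` (READINGS: the gauge-fixing weight `e^{−G/g²}` is dropped — it only changes `N` for
gauge-invariant integrands, p.255; print's `χ_k` on fluctuation variables is read as the upper all-small window) — and `LocMemTowerSF F ℰ
M j₀ prm ρ` = a family of effective actions `eff j`, each THE `eff` of a localised witness of `ρ j` read at height `j`, with `IsDescentRT`
for the densities and `IsSmallFieldRT` for consecutive `eff`'s (`LocMemTowerSF → LocMemTower`, `LocMemTowerSF.exists_eff`).

## What this file is NOT (honest framing)

* NOTHING of Bałaban's series is asserted: no `def … : Prop` names a theorem of the papers (0 named facts); the predicates are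
  inhabited only by whoever constructs a `LocWitness`.  That the height densities of the Wilson runs are localised members with an
  admissible schedule is [Balaban1987RG1] Thm 3 p.264 + [Balaban1985Variational] Prop. 9 + [Balaban1985UV3] Sect. D — a ROUTE
  obligation, not typed here (D-0026).
* READINGS, flagged: the complex tubes are polydiscs in the ambient norm of `𝔄`, not print's `U′ = exp iξA′` chart with the derivative
  conditions `|∇^ξA′| < α₁` of (1.13) and the plaquette condition (1.14) — a polydisc of radius `≲ α₁ξ/2` around a regular real
  configuration lies inside conditions (i)–(iii), so only a SMALLER domain than print's is demanded, and the auxiliary variable `𝐉` of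
  (1.8)–(1.9), condition (iv) (1.15)–(1.16), the `Gᶜ`-valued gauge invariance (1.19) and the Euclidean symmetry of p.263 are NOT encoded;
  `δanU` (fine-lattice group units) is, like `δreg` in `AdmissibleClassParams`, constrained along a schedule only to be positive, because
  its printed size `α₁ξ` depends on the number `K − j` of steps below the height, which `LocMemAtHeight` quantifies existentially;
  quasi-locality is typed through gauge-invariant composites (b3), not through the Landau-gauge derivative (190) itself (the tree's carrier
  of (190) is `B11.Prop9Printed`); the small-field renormalization step (0.19) relating CONSECUTIVE effective actions is NOT a clause of
  `LocWitness`/`LocMemTower` (on the windows the reference one-step fibre law is already `(e^{eff_{j+1}} + lf_{j+1})·dσ_V/(e^{eff_j(V)} +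
  lf_j(V))` by (a) at both heights and (c)); it is the separate schema `IsSmallFieldRT` / `LocMemTowerSF` of §3b, with the readings
  stated there.
* The inherited absolute large-field bound `lf ≤ e^{−cLF}·e^{c5|T^{(k)}|}` is weak at large volume; a RELATIVE per-history bound
  ([Balaban1988Convergent] (2.18) / [Balaban1989LargeFieldI] (0.2) style) is not typed here (requester: not needed for R1).
* As in `BalabanUVClass`: multi-scale domains are flattened to level-`k` footprints with weights; `Mem`-level monotonicity in the
  parameters (`Witness.relax`) is not re-derived for the new clauses.
* No `instance`, no notation, no named fact, no `sorry`; imports `BalabanAdmissibleClassParams` (hence `BalabanUVClass`, `T3UnitScaleTilt`,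
  `T3NestedUnitLaws`, `UnitaryModel`) and `HarnessLib`, nothing else.  The Mathlib scope `Matrix.Norms.L2Operator` is opened for the single
  declaration `CplxModel.specialUnitary` (as in `UnitaryModel`); everywhere else the normed-algebra structure of `𝔄` is an IMPLICIT argument
  unified from the type of `M`, so consumers instantiating `M := CplxModel.specialUnitary (Fin 2)` need not open that scope.

References (pages read 2026-08-28 on the held texts `paper:balaban1987-cmp109-rg-i-small-field` PDF pp.4–16 = journal pp.252–264;
`paper:balaban1985-cmp102-uv-stability-3d` pp.256–257, 262–268; `paper:balaban1985-cmp102-variational-background` pp.278–280, 305–309;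
`paper:balaban1989-cmp122-large-field-i` pp.176–177): T. Bałaban, CMP **109** (1987) 249–301 [Balaban1987RG1]; CMP **102** (1985) 255–275
[Balaban1985UV3]; CMP **102** (1985) 277–309 [Balaban1985Variational]; CMP **98** (1985) 17–51 [Balaban1985Averaging]; CMP **119** (1988)
243–285 [Balaban1988Convergent]; CMP **122** (1989) 175–202 [Balaban1989LargeFieldI].
-/

noncomputable section

open MeasureTheory
open Literature.MathematicalPhysics.QuantumFieldTheory
open Literature.MathematicalPhysics.QuantumFieldTheory.Balaban1983to89.T3ContinuumYM3Torus
open Literature.MathematicalPhysics.QuantumFieldTheory.Balaban1983to89.T3LevelShift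
open Literature.MathematicalPhysics.QuantumFieldTheory.Balaban1983to89.T3UnitScaleTilt
open Literature.MathematicalPhysics.QuantumFieldTheory.Balaban1983to89.T3NestedUnitLaws (descend measurable_descend)
open Literature.MathematicalPhysics.QuantumFieldTheory.Balaban1983to89.B5Eq118OneStroke (iterBlockOf)

namespace Literature.MathematicalPhysics.QuantumFieldTheory.Balaban1983to89.BalabanUVClass

/-! ## §1 The localised class at one level of one run (generic `Setup` vocabulary) -/

/-- **LOCALISED CLASS PARAMETERS AT ONE LEVEL** = `ClassParams` + four explicit reals: `δanU` = radius of the complex tube around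
regular FINE configurations on which the activities are holomorphic ([Balaban1987RG1] (1.13) p.262 `|A′| < α₁`, in the tree's
group-valued units of the finest lattice of the witness run — like `δreg`, its printed size depends on the number of steps below the
height); `δanV` = radius of the complex tube around an all-small DATUM on which the background is holomorphic ([Balaban1985Variational]
(172) p.305 `|V′ − 1| < C₁ε₁`, proportional to the window); `Cql`, `κql` = prefactor and decay rate of the quasi-locality of the
background in the datum ([Balaban1985Variational] (190) p.308: `O(1)`, `δ₀/8`).
[cite: Balaban1987RG1, (1.13) p.262; Balaban1985Variational, (172) p.305, (190) p.308] -/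
structure LocClassParams extends ClassParams where
  /-- radius of the complex tube around REGULAR FINE configurations on which the activities are holomorphic ((1.13) `α₁`) -/
  δanU : ℝ
  /-- radius of the complex tube around an all-small DATUM on which the background is holomorphic ((172) `C₁ε₁`) -/
  δanV : ℝ
  /-- prefactor of the quasi-locality bound -/
  Cql : ℝ
  /-- decay rate (per level-`k` lattice step) of the quasi-locality bound -/
  κql : ℝ

/-- **A COMPLEX MODEL OF THE GAUGE-GROUP INTERFACE**: a faithful monoid embedding `ι : G →* 𝔄` into a normed ℂ-algebra `𝔄` (print:
`G ⊂ U(N) ⊂ M_N(ℂ) ⊃ Gᶜ`, [Balaban1987RG1] p.252 «G is a Lie subgroup of a group of complex unitary matrices, for example G ⊂ U(N) … we also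
consider the complexified group Gᶜ. Elements of this group are defined as matrices of the form U = U′U»), COMPATIBLE with the interface
distance (`‖ι g − 1‖ = dist1 g`, [Balaban1985Averaging] (19) p.21 «in the sense of operator norm») and with `‖ι g‖ ≤ 1` (unitaries).
`Setup` DIVERGENCE F4 («the complexification Gᶜ [is a] further type parameter where needed»): this is that parameter.
[cite: Balaban1987RG1, §0 p.252; Balaban1985Averaging, (19) p.21] -/
structure CplxModel (G : Type*) [GaugeGroup G] (𝔄 : Type*) [NormedRing 𝔄] [NormedAlgebra ℂ 𝔄] where
  /-- the embedding `G ⊂ 𝔄` -/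
  ι : G →* 𝔄
  /-- the embedding is faithful -/
  injective : Function.Injective ι
  /-- the interface distance to `1` is the ambient norm distance -/
  norm_sub_one : ∀ g : G, ‖ι g - 1‖ = dist1 g
  /-- group elements have norm at most one (unitaries in the operator norm) -/
  norm_le_one : ∀ g : G, ‖ι g‖ ≤ 1

namespace CplxModel

-- the normed-algebra structure of `𝔄` is taken as IMPLICIT arguments (unified from the type of `M`), so that use sites whose `𝔄` carries
-- only scoped instances (e.g. `Matrix n n ℂ` under `Matrix.Norms.L2Operator`) elaborate without opening the scope
variable {P : Params} {j : ℕ} {G : Type*} [GaugeGroup G] {𝔄 : Type*} {instR : NormedRing 𝔄} {instA : NormedAlgebra ℂ 𝔄}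
  (M : CplxModel G 𝔄)

/-- A real configuration read in the complex model: `b ↦ ι(U_b)`. [cite: Balaban1987RG1, §0 p.252] -/
def embed (U : GaugeField P j G) : PBond P j → 𝔄 := fun b => M.ι (U b)

/-- Unfolding `embed`. [cite: Balaban1987RG1, §0 p.252] -/
@[simp] theorem embed_apply (U : GaugeField P j G) (b : PBond P j) : M.embed U b = M.ι (U b) := rfl

/-- `embed` is injective (the model is faithful). [cite: Balaban1987RG1, §0 p.252] -/
theorem embed_injective : Function.Injective (M.embed (P := P) (j := j)) := fun U U' h => by
  funext b
  exact M.injective (congrFun h b)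

/-- **THE COMPLEX TUBE** of radius `δ` around a real configuration `U`: complex configurations `W : bonds → 𝔄` with `‖W_b − ι(U_b)‖ < δ`
for every bond — the READING of print's `𝐔 = U′U`, `U′ = exp iξA′`, `|A′| < α₁` ([Balaban1987RG1] (1.11)–(1.13) p.262) and of
[Balaban1985Variational] (172) `V = V′V₀`, `|V′ − 1| < C₁ε₁` as a polydisc in the ambient norm. [cite: Balaban1987RG1, (1.11)-(1.13) p.262] -/
def cplxTube (δ : ℝ) (U : GaugeField P j G) : Set (PBond P j → 𝔄) :=
  {W | ∀ b, ‖W b - M.ι (U b)‖ < δ}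

/-- Membership in the tube, unfolded. [cite: Balaban1987RG1, (1.11)-(1.13) p.262] -/
theorem mem_cplxTube {δ : ℝ} {U : GaugeField P j G} {W : PBond P j → 𝔄} :
    W ∈ M.cplxTube δ U ↔ ∀ b, ‖W b - M.ι (U b)‖ < δ := Iff.rfl

/-- The real configuration itself lies in every tube of positive radius around it. [cite: Balaban1987RG1, (1.11)-(1.13) p.262] -/
theorem embed_mem_cplxTube_self {δ : ℝ} (hδ : 0 < δ) (U : GaugeField P j G) : M.embed U ∈ M.cplxTube δ U := fun b => by
  simpa using hδ

/-- `ι(g′) − ι(g) = (ι(g′g⁻¹) − 1)·ι(g)`: the multiplicative increment read additively. [cite: Balaban1985Averaging, (19) p.21] -/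
theorem ι_sub_eq (g g' : G) : M.ι g' - M.ι g = (M.ι (g' * g⁻¹) - 1) * M.ι g := by
  rw [sub_mul, one_mul, ← map_mul, inv_mul_cancel_right]

/-- **REAL CONFIGURATIONS `δ`-CLOSE TO `U` IN THE INTERFACE DISTANCE LIE IN THE TUBE**: `dist1(U′_b U_b⁻¹) < δ` for all `b` gives
`ι∘U′ ∈ cplxTube δ U` (from `‖ι g′ − ι g‖ ≤ dist1(g′g⁻¹)·‖ι g‖ ≤ dist1(g′g⁻¹)`) — print's «V = V′V₀, V′ small» configurations are in the
analyticity domain. [cite: Balaban1985Variational, (172) p.305] -/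
theorem embed_mem_cplxTube {δ : ℝ} {U U' : GaugeField P j G} (h : ∀ b, dist1 (U' b * (U b)⁻¹) < δ) :
    M.embed U' ∈ M.cplxTube δ U := fun b => by
  rw [embed_apply, M.ι_sub_eq]
  calc ‖(M.ι (U' b * (U b)⁻¹) - 1) * M.ι (U b)‖ ≤ ‖M.ι (U' b * (U b)⁻¹) - 1‖ * ‖M.ι (U b)‖ := norm_mul_le _ _
    _ ≤ dist1 (U' b * (U b)⁻¹) * 1 := by
        rw [M.norm_sub_one]
        exact mul_le_mul_of_nonneg_left (M.norm_le_one _) (GaugeGroup.dist1_nonneg _)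
    _ < δ := by rw [mul_one]; exact h b

/-- The tube is monotone in the radius. [cite: Balaban1987RG1, p.263] -/
theorem cplxTube_mono {δ δ' : ℝ} (h : δ ≤ δ') (U : GaugeField P j G) : M.cplxTube δ U ⊆ M.cplxTube δ' U :=
  fun _ hW b => (hW b).trans_le h

/-- The tube is OPEN in the product topology of `bonds → 𝔄` (so `AnalyticOnNhd` on it is holomorphy on an open set).
[cite: Balaban1987RG1, p.263] -/
theorem isOpen_cplxTube (δ : ℝ) (U : GaugeField P j G) : IsOpen (M.cplxTube δ U) := by
  have : M.cplxTube δ U = ⋂ b, {W : PBond P j → 𝔄 | ‖W b - M.ι (U b)‖ < δ} := by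
    ext W; simp [mem_cplxTube]
  rw [this]
  exact isOpen_iInter_of_finite fun b =>
    isOpen_lt ((continuous_apply b).sub continuous_const).norm continuous_const

end CplxModel

variable {P : Params} {k : ℕ} {G : Type*} [GaugeGroup G] [MeasurableSpace G]
  {𝔄 : Type*} {instR : NormedRing 𝔄} {instA : NormedAlgebra ℂ 𝔄}

/-- **A WITNESS OF MEMBERSHIP IN THE LOCALISED CLASS** for a density `r` on the level-`k` lattice of the run `P` (averaging family `av`,
parameters `prm`, complex model `M`): ALL the data and printed clauses of `BalabanUVClass.Witness av prm.toClassParams r` (background,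
localisation domains, activities, constant, large-field part; positivity, gauge invariance, locality, the bounds (25)/(44)–(46), the
sandwich (41)/(47), the large-field small factors) AND, beyond them: (a) the EXACT small-field representation `r = exp(eff) + lf`
([Balaban1987RG1] (0.22)–(0.24), Thm 1 p.259; [Balaban1989LargeFieldI] (0.2) p.176); (b1) complex-analytic LOCAL activities with the
bound (1.18) ON THE COMPLEX TUBES around regular configurations ([Balaban1987RG1] (1.7), (1.18) p.263); (b2) the background is locally
the restriction of a holomorphic map ([Balaban1985Variational] Prop. 9 p.309); (b3) gauge-invariant quasi-locality of
`V ↦ Re tr ∂(bg V)(p)` and `V ↦ act X (bg V)` (reading of (190) p.308).  See the module header for every READING. [cite: Balaban1987RG1, (0.22)-(0.25) pp.256-257, (1.7)-(1.19) pp.261-263; Balaban1985Variational, Prop. 9 (190) pp.308-309] -/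
structure LocWitness (av : (i : ℕ) → Averaging P i G) (prm : LocClassParams) (M : CplxModel G 𝔄)
    (r : GaugeField P k G → ℝ) extends Witness av prm.toClassParams r where
  /-- (a) THE REPRESENTATION IS EXACT ON THE ALL-SMALL SET: `r V = exp(−β·A(U_k(V)) + Σ_X E(X, U_k(V)) + cst) + lf V`
  ([Balaban1987RG1] (0.22) p.256 «A_k(g_k, V) = −(1/g_k²)A(U_k(V)) + E_k(U_k(V))», (0.24) p.257, Thm 1 p.259; the `Z = ∅` term of
  [Balaban1989LargeFieldI] (0.2) p.176, the other large-field regions collected in `lf`). -/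
  exact : ∀ V, PlaqSmall prm.δ V →
    r V = Real.exp (-(prm.β * wilsonAction4 (bg V)) + (∑ X, act X (bg V)) + cst) + lf V
  /-- (b1) THE COMPLEX EXTENSION OF THE ACTIVITIES `𝐄^{(j)}(X, 𝐔)` to complex configurations of the finest lattice ([Balaban1987RG1]
  p.261 «We assume that extensions of this type exist for all terms in the effective action», (1.9)). -/
  actC : Fin nDom → (PBond P 0 → 𝔄) → ℂ
  /-- The extension agrees with the activity at REGULAR real configurations ([Balaban1987RG1] p.263 «the action A_k(U) defined on the
  space U_k(ε₀), which is contained in all the spaces Uᶜ_j(X, α₀, α₁)»). -/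
  actC_real : ∀ X (U : GaugeField P 0 G), PlaqSmall prm.δreg U → actC X (M.embed U) = (act X U : ℂ)
  /-- LOCALITY of the extension ([Balaban1987RG1] (1.7) p.261 «the term corresponding to a domain X depends on U_j restricted to X»;
  p.263 «It depends on the configurations restricted to X»). -/
  actC_local : ∀ X (W W' : PBond P 0 → 𝔄), (∀ b ∈ supp X, W b = W' b) → actC X W = actC X W'
  /-- HOLOMORPHY on the complex tube of radius `δanU` around every REGULAR real fine configuration ([Balaban1987RG1] p.263 «defined and
  analytic on the space Uᶜ_j(X, α₀, α₁), with some positive, absolute constants α₀, α₁»; p.263 «there are some simple and natural spaces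
  contained in Uᶜ_j(X, α₀, α₁) … In particular the minimal configurations U_j … satisfy the above conditions»; [Balaban1985UV3] p.263 «The
  third property is the analyticity with respect to U₁»). -/
  actC_analytic : ∀ X (U : GaugeField P 0 G), PlaqSmall prm.δreg U → AnalyticOnNhd ℂ (actC X) (M.cplxTube prm.δanU U)
  /-- THE BOUND (1.18) HOLDS ON THE COMPLEX TUBE: `|𝐄^{(j)}(X, g_{j−1}, 𝐔, 𝐉)| ≤ E₀exp(−κd_j(X))` «for all configurations (𝐔, 𝐉) ∈
  Uᶜ_j(X, α₀, α₁)» ([Balaban1987RG1] (1.18) p.263), the level prefactor carried by `wt X` as in `Witness.act_bound`. -/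
  actC_bound : ∀ X (U : GaugeField P 0 G) (W : PBond P 0 → 𝔄), PlaqSmall prm.δreg U → W ∈ M.cplxTube prm.δanU U →
    ‖actC X W‖ ≤ wt X * Real.exp (-(prm.κ * len X))
  /-- (b2) THE BACKGROUND IS LOCALLY THE RESTRICTION OF A HOLOMORPHIC MAP OF THE DATUM ([Balaban1985Variational] Prop. 9 p.309 «The
  minimal configuration U_k(V) = U_k(V′V₀) in the axial gauge has an extension to an analytic function of Gᶜ-valued small configurations
  V′ on 𝔅_k», (172) p.305 `|V′ − 1| < C₁ε₁`, p.307 «for V′ with values in G it coincides with the minimal configuration»). -/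
  bg_analytic : ∀ V₀, PlaqSmall prm.δ V₀ → ∃ Φ : (PBond P k → 𝔄) → (PBond P 0 → 𝔄),
    AnalyticOnNhd ℂ Φ (M.cplxTube prm.δanV V₀) ∧
      ∀ V, PlaqSmall prm.δ V → M.embed V ∈ M.cplxTube prm.δanV V₀ → Φ (M.embed V) = M.embed (bg V)
  /-- (b3) QUASI-LOCALITY OF THE BACKGROUND'S PLAQUETTES IN THE DATUM (gauge-invariant READING of [Balaban1985Variational] Prop. 9 (190)
  p.308 `|(δ/δB(y′))𝓗(B, x)| ≤ O(1)·…·exp(−⅛δ₀d(y, y′))`): two all-small data agreeing on every level-`k` bond within `R` steps of the block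
  above the fine plaquette `p` have backgrounds whose plaquette traces at `p` differ by at most `Cql·δreg²·e^{−κql·R}` (`δreg²` = the
  natural size of `1 − Re tr` of a regular plaquette, (68) p.273). -/
  wilson_bg_quasilocal : ∀ (V V' : GaugeField P k G) (p : Plaq P 0) (R : ℕ), PlaqSmall prm.δ V → PlaqSmall prm.δ V' →
    (∀ c : PBond P k, Site.tdist (iterBlockOf k p.src) c.src ≤ R → V c = V' c) →
      |reTr (GaugeField.plaqHol (bg V) p) - reTr (GaugeField.plaqHol (bg V') p)| ≤
        prm.Cql * prm.δreg ^ 2 * Real.exp (-(prm.κql * R))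
  /-- (b3) QUASI-LOCALITY OF THE ACTIVITIES IN THE DATUM (same READING of (190), combined with the Lipschitz bound on the tube that
  analyticity and (1.18) give, [Balaban1987RG1] p.263): two all-small data agreeing on every level-`k` bond within `R` steps of the
  footprint of `X` have activities at their backgrounds within `wt X·e^{−κ𝓛(X)}·Cql·e^{−κql·R}`. -/
  act_bg_quasilocal : ∀ X (V V' : GaugeField P k G) (R : ℕ), PlaqSmall prm.δ V → PlaqSmall prm.δ V' →
    (∀ c : PBond P k, (∃ y ∈ foot X, Site.tdist y c.src ≤ R) → V c = V' c) →
      |act X (bg V) - act X (bg V')| ≤ wt X * Real.exp (-(prm.κ * len X)) * (prm.Cql * Real.exp (-(prm.κql * R)))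

/-- **MEMBERSHIP IN THE LOCALISED CLASS** at level `k` of the run `P` (averaging `av`, parameters `prm`, complex model `M`): a localised
witness exists.  A PREDICATE on the density; nothing is asserted about any particular density.
[cite: Balaban1987RG1, (0.22)-(0.25) pp.256-257, (1.18) p.263; Balaban1985Variational, Prop. 9 p.309] -/
def LocMem (av : (i : ℕ) → Averaging P i G) (prm : LocClassParams) (M : CplxModel G 𝔄) (r : GaugeField P k G → ℝ) : Prop :=
  Nonempty (LocWitness av prm M r)

/-- The sandwich's lower half FROM the exact representation: `exp(eff − slack) ≤ exp(eff) + lf` for `0 ≤ slack`, `0 ≤ lf` — the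
producer's discharge of `Witness.lower` ([Balaban1985UV3] (47) p.267 from [Balaban1987RG1] (0.22)). [cite: Balaban1985UV3, (47) p.267] -/
theorem lower_of_exact {ρV effV lfV slack : ℝ} (hs : 0 ≤ slack) (hlf : 0 ≤ lfV) (h : ρV = Real.exp effV + lfV) :
    Real.exp (effV - slack) ≤ ρV := by
  rw [h]
  have : Real.exp (effV - slack) ≤ Real.exp effV := Real.exp_le_exp.mpr (by linarith)
  linarith

/-- The sandwich's upper half FROM the exact representation: `exp(eff) + lf ≤ exp(eff + slack) + lf` for `0 ≤ slack` — the producer's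
discharge of `Witness.upper` ([Balaban1985UV3] (41) p.266 from [Balaban1987RG1] (0.22)). [cite: Balaban1985UV3, (41) p.266] -/
theorem upper_of_exact {ρV effV lfV slack : ℝ} (hs : 0 ≤ slack) (h : ρV = Real.exp effV + lfV) :
    ρV ≤ Real.exp (effV + slack) + lfV := by
  rw [h]
  have : Real.exp effV ≤ Real.exp (effV + slack) := Real.exp_le_exp.mpr (by linarith)
  linarith

namespace LocWitness

variable {av : (i : ℕ) → Averaging P i G} {prm : LocClassParams} {M : CplxModel G 𝔄} {r : GaugeField P k G → ℝ}
  (W : LocWitness av prm M r)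
include W

/-- (a) in terms of `Witness.eff`: `r V = exp(eff V) + lf V` on the all-small set. [cite: Balaban1987RG1, (0.22) p.256] -/
theorem exact_eff (V : GaugeField P k G) (hV : PlaqSmall prm.δ V) : r V = Real.exp (W.eff V) + W.lf V :=
  W.exact V hV

/-- On the all-small set the large-field part IS the defect of the exponentiated effective action: `lf V = r V − exp(eff V)`.
[cite: Balaban1989LargeFieldI, (0.2) p.176] -/
theorem lf_eq (V : GaugeField P k G) (hV : PlaqSmall prm.δ V) : W.lf V = r V - Real.exp (W.eff V) := by
  rw [W.exact_eff V hV]; ring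

/-- On the all-small set the density dominates the exponentiated effective action exactly (no slack): `exp(eff V) ≤ r V`.
[cite: Balaban1987RG1, (0.22) p.256] -/
theorem exp_eff_le (V : GaugeField P k G) (hV : PlaqSmall prm.δ V) : Real.exp (W.eff V) ≤ r V := by
  rw [W.exact_eff V hV]
  linarith [W.lf_nonneg V]

/-- On the all-small set the density is positive. [cite: Balaban1989LargeFieldI, p.176] -/
theorem pos (V : GaugeField P k G) (hV : PlaqSmall prm.δ V) : 0 < r V :=
  lt_of_lt_of_le (Real.exp_pos _) (W.exp_eff_le V hV)

/-- On the all-small set, with the large-field part suppressed as in `Witness.lf_le`: `|r V − exp(eff V)| ≤ e^{−cLF}·e^{c5|T^{(k)}|}`.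
[cite: Balaban1985UV3, Sect. D p.273] -/
theorem abs_sub_exp_eff_le (V : GaugeField P k G) (hV : PlaqSmall prm.δ V) :
    |r V - Real.exp (W.eff V)| ≤ Real.exp (-prm.cLF) * Real.exp (prm.c5 * Fintype.card (Site P k)) := by
  rw [← W.lf_eq V hV, abs_of_nonneg (W.lf_nonneg V)]
  exact W.lf_le V

/-- The logarithm of the density on the all-small set is at least the effective action. [cite: Balaban1987RG1, (0.22) p.256] -/
theorem eff_le_log (V : GaugeField P k G) (hV : PlaqSmall prm.δ V) : W.eff V ≤ Real.log (r V) := by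
  rw [← Real.log_exp (W.eff V)]
  exact Real.log_le_log (Real.exp_pos _) (W.exp_eff_le V hV)

/-- The complex activity at the (embedded) background of an all-small datum is the real activity, provided the background is regular
(it is: `Witness.bg_regular`). [cite: Balaban1987RG1, p.263] -/
theorem actC_embed_bg (X : Fin W.nDom) (V : GaugeField P k G) (hV : PlaqSmall prm.δ V) :
    W.actC X (M.embed (W.bg V)) = (W.act X (W.bg V) : ℂ) :=
  W.actC_real X (W.bg V) (W.bg_regular V hV)

/-- The complex activities are holomorphic on the tube around the background of every all-small datum (the background is regular,
`Witness.bg_regular`). [cite: Balaban1987RG1, p.263] -/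
theorem actC_analytic_bg (X : Fin W.nDom) (V : GaugeField P k G) (hV : PlaqSmall prm.δ V) :
    AnalyticOnNhd ℂ (W.actC X) (M.cplxTube prm.δanU (W.bg V)) :=
  W.actC_analytic X (W.bg V) (W.bg_regular V hV)

/-- The complex activity is holomorphic AT the embedded background of an all-small datum (`0 < δanU`). [cite: Balaban1987RG1, p.263] -/
theorem analyticAt_actC_embed_bg (hδ : 0 < prm.δanU) (X : Fin W.nDom) (V : GaugeField P k G) (hV : PlaqSmall prm.δ V) :
    AnalyticAt ℂ (W.actC X) (M.embed (W.bg V)) :=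
  W.actC_analytic_bg X V hV _ (M.embed_mem_cplxTube_self hδ _)

/-- The bound (1.18) on the tube around the background of an all-small datum. [cite: Balaban1987RG1, (1.18) p.263] -/
theorem actC_bound_bg (X : Fin W.nDom) (V : GaugeField P k G) (hV : PlaqSmall prm.δ V) (W' : PBond P 0 → 𝔄)
    (hW' : W' ∈ M.cplxTube prm.δanU (W.bg V)) : ‖W.actC X W'‖ ≤ W.wt X * Real.exp (-(prm.κ * W.len X)) :=
  W.actC_bound X (W.bg V) W' (W.bg_regular V hV) hW'

/-- The complex bound at a REAL regular configuration recovers a real bound `|act X U| ≤ wt X e^{−κ𝓛(X)}` at every regular `U` (for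
`0 < δanU`; at backgrounds this is `Witness.act_bound`). [cite: Balaban1987RG1, (1.18) p.263] -/
theorem abs_act_le_of_regular (hδ : 0 < prm.δanU) (X : Fin W.nDom) (U : GaugeField P 0 G) (hU : PlaqSmall prm.δreg U) :
    |W.act X U| ≤ W.wt X * Real.exp (-(prm.κ * W.len X)) := by
  have h := W.actC_bound X U (M.embed U) hU (M.embed_mem_cplxTube_self hδ U)
  rwa [W.actC_real X U hU, Complex.norm_real, Real.norm_eq_abs] at h

/-- Quasi-locality of the activities with agreement radius `0` (every datum pair): the variation of one activity across the all-small
set is at most `wt X e^{−κ𝓛(X)}·Cql`. [cite: Balaban1985Variational, (190) p.308] -/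
theorem abs_act_bg_sub_le (X : Fin W.nDom) (V V' : GaugeField P k G) (hV : PlaqSmall prm.δ V) (hV' : PlaqSmall prm.δ V')
    (hagree : ∀ c : PBond P k, (∃ y ∈ W.foot X, Site.tdist y c.src ≤ 0) → V c = V' c) :
    |W.act X (W.bg V) - W.act X (W.bg V')| ≤ W.wt X * Real.exp (-(prm.κ * W.len X)) * prm.Cql := by
  simpa using W.act_bg_quasilocal X V V' 0 hV hV' hagree

/-- A localised witness IS a witness of the sandwich class (forgetful map). [cite: Balaban1985UV3, (41)-(47) pp.266-267] -/
theorem mem : Mem av prm.toClassParams r := ⟨W.toWitness⟩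

end LocWitness

namespace LocMem

variable {av : (i : ℕ) → Averaging P i G} {prm : LocClassParams} {M : CplxModel G 𝔄} {r : GaugeField P k G → ℝ}

/-- A localised witness gives localised membership. [cite: Balaban1987RG1, (0.22)-(0.25) pp.256-257] -/
theorem of_witness (W : LocWitness av prm M r) : LocMem av prm M r := ⟨W⟩

/-- **LOCALISED MEMBERS ARE MEMBERS**: `LocMem av prm M r → Mem av prm.toClassParams r`. [cite: Balaban1985UV3, (41)-(47) pp.266-267] -/
theorem mem (h : LocMem av prm M r) : Mem av prm.toClassParams r := by
  obtain ⟨W⟩ := h; exact W.mem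

/-- Localised members are positive on the all-small set. [cite: Balaban1989LargeFieldI, p.176] -/
theorem pos (h : LocMem av prm M r) (V : GaugeField P k G) (hV : PlaqSmall prm.δ V) : 0 < r V := by
  obtain ⟨W⟩ := h; exact W.pos V hV

/-- Localised members are non-negative, measurable, gauge invariant and obey (5) (through `Mem`). [cite: Balaban1985UV3, Thm 1 (5) pp.256-257] -/
theorem le_exp (h : LocMem av prm M r) (V : GaugeField P k G) : r V ≤ Real.exp (prm.c5 * Fintype.card (Site P k)) :=
  h.mem.le_exp V

/-- On the all-small set a localised member is, up to the suppressed large-field part, EXACTLY the exponential of a localised effective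
action of its (regular, minimising) background: the existential form of clause (a) for consumers that do not open the witness.
[cite: Balaban1987RG1, (0.22)-(0.24) pp.256-257] -/
theorem exists_eff (h : LocMem av prm M r) (V : GaugeField P k G) (hV : PlaqSmall prm.δ V) :
    ∃ U : GaugeField P 0 G, Averaging.iter av k U = V ∧ PlaqSmall prm.δreg U ∧
      ∃ e l : ℝ, 0 ≤ l ∧ l ≤ Real.exp (-prm.cLF) * Real.exp (prm.c5 * Fintype.card (Site P k)) ∧
        |e + prm.β * wilsonAction4 U| ≤ (prm.Ccov + prm.cE) * Fintype.card (Site P k) ∧ r V = Real.exp e + l := by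
  obtain ⟨W⟩ := h
  exact ⟨W.bg V, W.iter_bg V hV, W.bg_regular V hV, W.eff V, W.lf V, W.lf_nonneg V, W.lf_le V,
    W.abs_eff_add_main_le V hV, W.exact_eff V hV⟩

end LocMem

/-! ### Non-vacuity: the initial density is a localised member at level `0` -/

section Initial

variable [RegularGaugeGroup G]

/-- `(x + e_μ) + e_ν = (x + e_ν) + e_μ` on the torus (local helper; the tree's `HiggsHodgeIdentity.shift_comm` is outside this file's
import cone — re-proved). [folklore] -/
private theorem shift_comm' {j : ℕ} (x : Site P j) (μ ν : Fin P.d) : (x.shift μ).shift ν = (x.shift ν).shift μ := by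
  funext κ
  by_cases h1 : κ = ν
  · subst h1
    by_cases h2 : κ = μ
    · subst h2; rfl
    · simp [Site.shift, Function.update_self, Function.update_of_ne h2]
  · by_cases h2 : κ = μ
    · subst h2
      simp [Site.shift, Function.update_self, Function.update_of_ne h1]
    · simp [Site.shift, Function.update_of_ne h1, Function.update_of_ne h2]

omit [MeasurableSpace G] [RegularGaugeGroup G] in
/-- `U^u(∂p) = u(x) U(∂p) u(x)⁻¹` (local helper; the tree's `T4WilsonGaugeFlatDirection.plaqHol_gaugeAct` is outside this file's import
cone — re-proved; [Balaban1985Averaging] (9), (12) p.19). [cite: Balaban1985Averaging, (12) p.19] -/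
private theorem plaqHol_gaugeAct' {j : ℕ} (u : GaugeTransf P j G) (U : GaugeField P j G) (p : Plaq P j) :
    GaugeField.plaqHol (GaugeField.gaugeAct u U) p = u p.src * GaugeField.plaqHol U p * (u p.src)⁻¹ := by
  simp only [GaugeField.plaqHol, GaugeField.gaugeAct, PBond.tgt, shift_comm' p.src p.ν p.μ]
  group

omit [MeasurableSpace G] [RegularGaugeGroup G] in
/-- The Wilson action is gauge invariant (local helper; the tree's `T4WilsonGaugeFlatDirection.wilsonAction_gaugeAct` is outside this
file's import cone — re-proved). [cite: Balaban1985Averaging, (12) p.19] -/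
private theorem wilsonAction4_gaugeAct' {j : ℕ} (u : GaugeTransf P j G) (U : GaugeField P j G) :
    wilsonAction4 (GaugeField.gaugeAct u U) = wilsonAction4 U := by
  unfold wilsonAction4 wilsonAction
  exact Finset.sum_congr rfl fun p _ => by rw [plaqHol_gaugeAct', GaugeGroup.reTr_conj]

/-- **THE PARAMETERS OF THE INITIAL DENSITY**: window `δ` (any), regular window `= δ`, large threshold `δL` (any), coefficient `β ≥ 0`,
decay rates `κ`, `κql` (any), diameter constant `M` (any), budgets `Ccov = cE = slack = cLF = c5 = 0`, tube radii `δan` (any),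
quasi-locality prefactor `Cql = 2/δ²` (so that `Cql·δreg² = 2` bounds a difference of two traces). [cite: Balaban1985UV3, (1) p.256] -/
def initialParams (δ δL β κ M δan κql : ℝ) : LocClassParams where
  δ := δ
  δreg := δ
  δL := δL
  β := β
  κ := κ
  M := M
  Ccov := 0
  cE := 0
  slack := 0
  cLF := 0
  c5 := 0
  δanU := δan
  δanV := δan
  Cql := 2 / δ ^ 2
  κql := κql

/-- **NON-VACUITY — BAŁABAN'S INITIAL DENSITY `ρ₀ = exp(−β·A(U))` ([Balaban1985UV3] (1) p.256 «ρ₀(U) = exp[−(1/g₀²)A(U) − E]», here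
`E = 0`) IS A LOCALISED-CLASS MEMBER AT LEVEL `k = 0`** for every averaging family, every complex model and every `β ≥ 0`:
background `= id` (zero averaging steps: `U₀(V) = V` is trivially the minimiser), NO localisation domains, `cst = 0`, `lf = 0`; the exact
representation is `exp(−βA(V)) = exp(−βA(V) + 0 + 0) + 0`, the holomorphic background map is the identity, the quasi-locality of the
plaquette traces is locality (`R ≥ 1`: the plaquette's bonds agree) or the trivial bound `|Re tr a − Re tr b| ≤ 2 = Cql·δreg²` (`R = 0`;
a `δ`-small datum exists only if `δ > 0`), and the
large-field clauses hold with exponent `0` because `exp(−βA) ≤ 1`. [cite: Balaban1985UV3, (1) p.256] -/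
def LocWitness.initial (av : (i : ℕ) → Averaging P i G) (M : CplxModel G 𝔄) {δ δL β κ Mc δan κql : ℝ} (hβ : 0 ≤ β) :
    LocWitness (k := 0) av (initialParams δ δL β κ Mc δan κql) M (fun V => Real.exp (-(β * wilsonAction4 V))) where
  bg := id
  nDom := 0
  supp := Fin.elim0
  foot := Fin.elim0
  len := Fin.elim0
  wt := Fin.elim0
  act := Fin.elim0
  cst := 0
  lf := fun _ => 0
  nonneg V := (Real.exp_pos _).le
  measurable := (measurable_const.mul (Missing.measurable_wilsonAction4 RegularGaugeGroup.measurable_reTr)).neg.exp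
  gaugeInvariant u U := by simp only [wilsonAction4_gaugeAct']
  isBackground V hV := ⟨rfl, hV, fun U _ hU => by simp only [id]; rw [show U = V from hU]⟩
  foot_nonempty X := X.elim0
  supp_foot X := X.elim0
  len_nonneg X := X.elim0
  wt_nonneg X := X.elim0
  diam_foot X := X.elim0
  act_local X := X.elim0
  act_gaugeInvariant X := X.elim0
  act_bound X := X.elim0
  cover y := by simp [initialParams]
  cst_abs_le := by simp [initialParams]
  lower V hV := by simp [initialParams]
  upper V hV := by simp [initialParams]
  lf_nonneg V := le_rfl
  lf_le V := by positivity
  large V S hS := by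
    simp only [initialParams, zero_mul, neg_zero, Real.exp_zero, mul_one]
    exact Real.exp_le_one_iff.mpr (by nlinarith [wilsonAction4_nonneg V])
  exact V hV := by simp [initialParams]
  actC := Fin.elim0
  actC_real X := X.elim0
  actC_local X := X.elim0
  actC_analytic X := X.elim0
  actC_bound X := X.elim0
  bg_analytic V₀ hV₀ := ⟨id, analyticOnNhd_id, fun V _ _ => rfl⟩
  wilson_bg_quasilocal V V' p R hV hV' hagree := by
    by_cases hR : 1 ≤ R
    · -- the four bonds of `∂p` start within one step of `p.src`: the data agree there, so the plaquette variables coincide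
      have hb : ∀ c : PBond P 0, Site.tdist p.src c.src ≤ 1 → V c = V' c :=
        fun c hc => hagree c (by simpa using hc.trans hR)
      have h0 : ∀ x : Site P 0, Site.tdist x x = 0 := fun x => by simp [Site.tdist]
      have h1 : ∀ (x : Site P 0) (μ : Fin P.d), Site.tdist x (x.shift μ) ≤ 1 := fun x μ => by
        classical
        unfold Site.tdist
        calc ∑ ν : Fin P.d, min (x ν - x.shift μ ν).val (x.shift μ ν - x ν).val
            ≤ ∑ ν : Fin P.d, if ν = μ then 1 else 0 := Finset.sum_le_sum fun ν _ => by
              by_cases hν : ν = μ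
              · subst hν
                simp only [Site.shift, Function.update_self, add_sub_cancel_left, if_true]
                exact min_le_of_right_le (by
                  rcases Nat.lt_or_ge 1 (P.sitesPerDir 0) with h | h
                  · haveI : Fact (1 < P.sitesPerDir 0) := ⟨h⟩
                    rw [ZMod.val_one]
                  · exact (ZMod.val_le _).trans (by omega))
              · simp [Site.shift, Function.update_of_ne hν]
          _ = 1 := by simp
      have e1 : V ⟨p.src, p.μ⟩ = V' ⟨p.src, p.μ⟩ := hb _ (by simp [h0])
      have e2 : V ⟨p.src.shift p.μ, p.ν⟩ = V' ⟨p.src.shift p.μ, p.ν⟩ := hb _ (h1 _ _)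
      have e3 : V ⟨p.src.shift p.ν, p.μ⟩ = V' ⟨p.src.shift p.ν, p.μ⟩ := hb _ (h1 _ _)
      have e4 : V ⟨p.src, p.ν⟩ = V' ⟨p.src, p.ν⟩ := hb _ (by simp [h0])
      have : GaugeField.plaqHol (id V) p = GaugeField.plaqHol (id V') p := by
        simp only [id, GaugeField.plaqHol, e1, e2, e3, e4]
      rw [this, sub_self, abs_zero]
      exact mul_nonneg (mul_nonneg (by simp only [initialParams]; positivity) (sq_nonneg _)) (Real.exp_nonneg _)
    · have hR0 : R = 0 := by omega
      subst hR0
      have ha := RegularGaugeGroup.abs_reTr_le_one (GaugeField.plaqHol (id V) p)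
      have hb := RegularGaugeGroup.abs_reTr_le_one (GaugeField.plaqHol (id V') p)
      -- a `δ`-small datum exists, so `δ > 0` and `Cql·δreg² = (2/δ²)·δ² = 2`
      have hδ : 0 < δ := lt_of_le_of_lt (GaugeGroup.dist1_nonneg _) (hV p)
      have hC : (2 / δ ^ 2) * δ ^ 2 = 2 := div_mul_cancel₀ 2 (pow_ne_zero 2 hδ.ne')
      simp only [initialParams, Nat.cast_zero, mul_zero, neg_zero, Real.exp_zero, mul_one, hC]
      exact (abs_sub _ _).trans (by linarith)
  act_bg_quasilocal X := X.elim0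

/-- The initial density is a localised member at level `0`. [cite: Balaban1985UV3, (1) p.256] -/
theorem locMem_initial (av : (i : ℕ) → Averaging P i G) (M : CplxModel G 𝔄) {δ δL β κ Mc δan κql : ℝ} (hβ : 0 ≤ β) :
    LocMem (k := 0) av (initialParams δ δL β κ Mc δan κql) M (fun V => Real.exp (-(β * wilsonAction4 V))) :=
  ⟨LocWitness.initial av M hβ⟩

end Initial

/-! ## §2 Admissible schedules of localised parameters along the heights of a `T3Family` -/

/-- **ADMISSIBLE LOCALISED SCHEDULE** along the heights `j` of the d = 3 torus family `F` at unit-lattice coupling `γ` and threshold profile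
`(b₀, p₀)`: the `ClassParams` part is admissible (`AdmissibleClassParams`), the datum tube radius is at least a fixed multiple of the
window scale `θ(j) = g_jp(g_j)` ([Balaban1985Variational] (172) p.305: the analyticity radius `C₁ε₁` is proportional to the regularity
`ε₁` (7) of the datum), the fine tube radius is positive ([Balaban1987RG1] p.263: `α₀, α₁` «absolute constants … independent of X and
j» in the `ξ`-scaled units — in the tree's group-valued units of the witness run only positivity is expressible on `prm j` alone, as for
`δreg`), the quasi-locality rate is bounded below and the prefactor above uniformly in the height ((190) p.308: absolute `δ₀/8` and `O(1)`).
[cite: Balaban1985Variational, (172) p.305, (190) p.308; Balaban1987RG1, p.263] -/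
structure LocAdmissibleClassParams (F : T3Family) (γ b₀ p₀ : ℝ) (prm : ℕ → LocClassParams) : Prop where
  /-- the sandwich-class parameters are admissible -/
  base : AdmissibleClassParams F γ b₀ p₀ (fun j => (prm j).toClassParams)
  /-- THE DATUM TUBE RADIUS IS AT LEAST A FIXED MULTIPLE OF THE WINDOW SCALE: `c₀θ(j) ≤ δanV_j`, `c₀ > 0` ((172): `C₁ε₁`) -/
  tubeV : ∃ c₀ : ℝ, 0 < c₀ ∧ ∀ j, c₀ * θBal F.L γ b₀ p₀ j ≤ (prm j).δanV
  /-- THE FINE TUBE RADIUS IS POSITIVE ((1.13)/p.263: «positive, absolute constants α₀, α₁» in the `ξ`-scaled units; READING as for `δreg`) -/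
  tubeU : ∀ j, 0 < (prm j).δanU
  /-- THE QUASI-LOCALITY RATE IS BOUNDED BELOW: `0 < κ₀ ≤ κql_j` -/
  qlDecay : ∃ κ₀ : ℝ, 0 < κ₀ ∧ ∀ j, κ₀ ≤ (prm j).κql
  /-- THE QUASI-LOCALITY PREFACTOR IS BOUNDED: `Cql_j ≤ C₀` -/
  qlPrefactor : ∃ C₀ : ℝ, ∀ j, (prm j).Cql ≤ C₀

namespace LocAdmissibleClassParams

variable {F : T3Family} {γ b₀ p₀ : ℝ} {prm : ℕ → LocClassParams}

/-- The quasi-locality rates of an admissible localised schedule are positive. [cite: Balaban1985Variational, (190) p.308] -/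
theorem κql_pos (h : LocAdmissibleClassParams F γ b₀ p₀ prm) (j : ℕ) : 0 < (prm j).κql := by
  obtain ⟨κ₀, hκ₀, hκ⟩ := h.qlDecay
  exact lt_of_lt_of_le hκ₀ (hκ j)

/-- The windows of an admissible localised schedule are non-degenerate (`0 < γ ≤ 1`, `0 < b₀`). [cite: Balaban1985UV3, (47) p.267] -/
theorem delta_pos (h : LocAdmissibleClassParams F γ b₀ p₀ prm) (hγ : 0 < γ) (hγ1 : γ ≤ 1) (hb : 0 < b₀) (j : ℕ) :
    0 < (prm j).δ :=
  h.base.delta_pos hγ hγ1 hb j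

/-- The datum tube radii of an admissible localised schedule are positive when the windows' scale is (`0 < γ ≤ 1`, `0 < b₀`).
[cite: Balaban1985Variational, (172) p.305] -/
theorem δanV_pos (h : LocAdmissibleClassParams F γ b₀ p₀ prm) (hγ : 0 < γ) (hγ1 : γ ≤ 1) (hb : 0 < b₀) (j : ℕ) :
    0 < (prm j).δanV := by
  obtain ⟨c₀, hc₀, hc⟩ := h.tubeV
  have hθ : 0 < 2 * θBal F.L γ b₀ p₀ j := by
    -- `0 < θ(j)` through `delta_pos` of the PRINTED schedule (whose window is `2θ(j)`)
    have hp := (printedSchedule_admissible F γ b₀ p₀ one_pos 0 0 one_pos).delta_pos hγ hγ1 hb j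
    simpa [printedSchedule] using hp
  exact lt_of_lt_of_le (by nlinarith) (hc j)

/-- The fine tube radii of an admissible localised schedule are positive. [cite: Balaban1987RG1, p.263] -/
theorem δanU_pos (h : LocAdmissibleClassParams F γ b₀ p₀ prm) (j : ℕ) : 0 < (prm j).δanU :=
  h.tubeU j

end LocAdmissibleClassParams

/-- **THE PRINTED LOCALISED SCHEDULE**: `printedSchedule` of `BalabanAdmissibleClassParams` extended by `δanU_j = R₀` (the regular-window
constant), `δanV_j = 2θ(j)`, `Cql_j = C₀`, `κql_j = κ₀`.  A TEMPLATE for producers; nothing is claimed about densities.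
[cite: Balaban1985Variational, (172) p.305, (190) p.308] -/
def printedLocSchedule (F : T3Family) (γ b₀ p₀ κ₀ M₀ C₀ R₀ : ℝ) (j : ℕ) : LocClassParams where
  toClassParams := printedSchedule F γ b₀ p₀ κ₀ M₀ C₀ R₀ j
  δanU := R₀
  δanV := 2 * θBal F.L γ b₀ p₀ j
  Cql := C₀
  κql := κ₀

/-- **NON-VACUITY OF THE SCHEDULE PREDICATE**: the printed localised schedule is admissible (`0 < κ₀`, `0 < R₀`).
[cite: Balaban1985Variational, (172) p.305, (190) p.308] -/
theorem printedLocSchedule_admissible (F : T3Family) (γ b₀ p₀ : ℝ) {κ₀ : ℝ} (hκ₀ : 0 < κ₀) (M₀ C₀ : ℝ) {R₀ : ℝ}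
    (hR₀ : 0 < R₀) : LocAdmissibleClassParams F γ b₀ p₀ (printedLocSchedule F γ b₀ p₀ κ₀ M₀ C₀ R₀) where
  base := printedSchedule_admissible F γ b₀ p₀ hκ₀ M₀ C₀ hR₀
  tubeV := ⟨2, two_pos, fun _ => le_rfl⟩
  tubeU := fun _ => hR₀
  qlDecay := ⟨κ₀, hκ₀, fun _ => le_rfl⟩
  qlPrefactor := ⟨C₀, fun _ => le_rfl⟩

/-! ## §3 The localised class on the d = 3 height lattices, and the tower clause -/

section Height

variable (F : T3Family) {G : Type*} [GaugeGroup G] [MeasurableSpace G] {𝔄 : Type*} {instR : NormedRing 𝔄} {instA : NormedAlgebra ℂ 𝔄}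

/-- **LOCALISED MEMBERSHIP OF A HEIGHT-`j` DENSITY READ ON THE RUN `K ≥ j`** (mirrors `MemOfRun`): the density `r` on
`GaugeField (F.P j) 0 G`, read on level `K − j` of run `K` (`readAtLevel`), is in the localised class for the block averaging
`BlockAveraging.blockAvg ℰ` of run `K`; the background lives on run `K`'s finest lattice.
[cite: Balaban1987RG1, (0.22)-(0.25) pp.256-257, (1.18) p.263] -/
def LocMemOfRun (ℰ : LoopAverage G) (M : CplxModel G 𝔄) {j K : ℕ} (hK : j ≤ K) (prm : LocClassParams)
    (r : GaugeField (F.P j) 0 G → ℝ) : Prop :=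
  LocMem (P := F.P K) (k := K - j) (fun i => BlockAveraging.blockAvg (P := F.P K) (j := i) ℰ) prm M (readAtLevel F hK r)

/-- **LOCALISED MEMBERSHIP AT HEIGHT `j`** (mirrors `MemAtHeight`): for SOME run `K ≥ j` the height-`j` density read on run `K` is in the
localised class. [cite: Balaban1987RG1, (0.22)-(0.25) pp.256-257, (1.18) p.263] -/
def LocMemAtHeight (ℰ : LoopAverage G) (M : CplxModel G 𝔄) (j : ℕ) (prm : LocClassParams) (r : GaugeField (F.P j) 0 G → ℝ) :
    Prop :=
  ∃ K : ℕ, ∃ hK : j ≤ K, LocMemOfRun F ℰ M hK prm r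

variable {F}

/-- A localised run-`K` membership is a run-`K` membership. [cite: Balaban1985UV3, (41)-(47) pp.266-267] -/
theorem LocMemOfRun.memOfRun {ℰ : LoopAverage G} {M : CplxModel G 𝔄} {j K : ℕ} {hK : j ≤ K} {prm : LocClassParams}
    {r : GaugeField (F.P j) 0 G → ℝ} (h : LocMemOfRun F ℰ M hK prm r) : MemOfRun F ℰ hK prm.toClassParams r :=
  LocMem.mem h

/-- A localised run-`K` membership is a localised height membership. [cite: Balaban1987RG1, (0.22)-(0.25) pp.256-257] -/
theorem LocMemOfRun.locMemAtHeight {ℰ : LoopAverage G} {M : CplxModel G 𝔄} {j K : ℕ} {hK : j ≤ K} {prm : LocClassParams}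
    {r : GaugeField (F.P j) 0 G → ℝ} (h : LocMemOfRun F ℰ M hK prm r) : LocMemAtHeight F ℰ M j prm r :=
  ⟨K, hK, h⟩

/-- **LOCALISED HEIGHT MEMBERS ARE HEIGHT MEMBERS**: `LocMemAtHeight → MemAtHeight` (the organ's present hypothesis is implied).
[cite: Balaban1985UV3, (41)-(47) pp.266-267] -/
theorem LocMemAtHeight.memAtHeight {ℰ : LoopAverage G} {M : CplxModel G 𝔄} {j : ℕ} {prm : LocClassParams}
    {r : GaugeField (F.P j) 0 G → ℝ} (h : LocMemAtHeight F ℰ M j prm r) : MemAtHeight F ℰ j prm.toClassParams r := by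
  obtain ⟨K, hK, hm⟩ := h
  exact ⟨K, hK, hm.memOfRun⟩

/-- Localised height members are non-negative. [cite: Balaban1989LargeFieldI, p.176] -/
theorem LocMemAtHeight.nonneg {ℰ : LoopAverage G} {M : CplxModel G 𝔄} {j : ℕ} {prm : LocClassParams}
    {r : GaugeField (F.P j) 0 G → ℝ} (h : LocMemAtHeight F ℰ M j prm r) (V : GaugeField (F.P j) 0 G) : 0 ≤ r V :=
  h.memAtHeight.nonneg V

/-- Localised height members are measurable. [cite: Balaban1985Averaging, (10) p.19] -/
theorem LocMemAtHeight.measurable {ℰ : LoopAverage G} {M : CplxModel G 𝔄} {j : ℕ} {prm : LocClassParams}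
    {r : GaugeField (F.P j) 0 G → ℝ} (h : LocMemAtHeight F ℰ M j prm r) : Measurable r :=
  h.memAtHeight.measurable

variable [HaarData G]
variable (F)

/-- **(c) THE TOWER CLAUSE — `ρdn` IS THE RENORMALIZATION TRANSFORM OF `ρup` ALONG THE ONE-STEP DESCENT** between the height lattices
`j + 1 → j` of the family (`descend F ℰ j` = one (0.4) block averaging of the finest lattice of the `(j+1)`-th approximation read on the
finest lattice of the `j`-th, `T3NestedUnitLaws`), in the push-forward reading of `Setup.IsRT` (DIVERGENCE F7: no pointwise
δ-functions): `∫ ρdn·f dU_j = ∫ ρup·(f ∘ descend) dU_{j+1}` for every bounded measurable `f` — [Balaban1985UV3] (2) p.256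
«ρ_{k+1} = Tρ_k», [Balaban1985Averaging] (10) p.19 `(Tρ)(V) = ∫ dU δ(ŪV⁻¹) ρ(U)`, [Balaban1987RG1] (0.13) p.254 «(Tρ)(V) = ∫ dU t(V, U) ρ(U)»
(for gauge-invariant `ρ` the gauge-fixed kernels (0.14)–(0.16) give the same `Tρ`, p.255 «the integrand does not depend on u and the
integral over u is equal to 1»). [cite: Balaban1985UV3, (2) p.256; Balaban1985Averaging, (10) p.19; Balaban1987RG1, (0.13) p.254] -/
def IsDescentRT (ℰ : LoopAverage G) (j : ℕ) (ρup : GaugeField (F.P (j + 1)) 0 G → ℝ) (ρdn : GaugeField (F.P j) 0 G → ℝ) : Prop :=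
  ∀ f : GaugeField (F.P j) 0 G → ℝ, Measurable f → (∃ C : ℝ, ∀ V, |f V| ≤ C) →
    ∫ V, ρdn V * f V ∂(fieldMeasure (F.P j) 0 G) = ∫ U, ρup U * f (descend F ℰ j U) ∂(fieldMeasure (F.P (j + 1)) 0 G)

/-- **LOCALISED CLASS TRAJECTORY (heightwise form, from height `j₀` on)**: every height density is a localised member with the height's
parameters AND is the renormalization transform of the next finer one along the descent — the RUN STRUCTURE [Balaban1985UV3] (2)
«ρ_{k+1} = Tρ_k» imposed on the whole trajectory, so that the one-step fibre laws of the trajectory are those of its own densities and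
nothing else. [cite: Balaban1985UV3, (2) p.256; Balaban1987RG1, (0.22)-(0.25) pp.256-257] -/
def LocMemTower (ℰ : LoopAverage G) (M : CplxModel G 𝔄) (j₀ : ℕ) (prm : ℕ → LocClassParams)
    (ρ : (j : ℕ) → GaugeField (F.P j) 0 G → ℝ) : Prop :=
  ∀ j, j₀ ≤ j → LocMemAtHeight F ℰ M j (prm j) (ρ j) ∧ IsDescentRT F ℰ j (ρ (j + 1)) (ρ j)

/-- **LOCALISED CLASS TRAJECTORY OF ONE RUN `K`** (finite form, heights `j₀ ≤ j ≤ K`, ONE witness depth for all of them): every such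
density `ρ j` read on run `K` is a localised member, and consecutive heights below `K` are related by the descent renormalization
transform — the printed situation [Balaban1985UV3] (2) p.256 «This yields a sequence of densities ρ_k defined inductively by
ρ_{k+1} = Tρ_k … We terminate constructions of the densities ρ_k when we reach the unit lattice». [cite: Balaban1985UV3, (2) p.256] -/
def LocMemTowerOfRun (ℰ : LoopAverage G) (M : CplxModel G 𝔄) (j₀ K : ℕ) (prm : ℕ → LocClassParams)
    (ρ : (j : ℕ) → GaugeField (F.P j) 0 G → ℝ) : Prop :=
  (∀ j, j₀ ≤ j → ∀ hK : j ≤ K, LocMemOfRun F ℰ M hK (prm j) (ρ j)) ∧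
    ∀ j, j₀ ≤ j → j < K → IsDescentRT F ℰ j (ρ (j + 1)) (ρ j)

variable {F}

/-- Projection: the height members of a localised trajectory. [cite: Balaban1987RG1, (0.22)-(0.25) pp.256-257] -/
theorem LocMemTower.locMemAtHeight {ℰ : LoopAverage G} {M : CplxModel G 𝔄} {j₀ : ℕ} {prm : ℕ → LocClassParams}
    {ρ : (j : ℕ) → GaugeField (F.P j) 0 G → ℝ} (h : LocMemTower F ℰ M j₀ prm ρ) {j : ℕ} (hj : j₀ ≤ j) :
    LocMemAtHeight F ℰ M j (prm j) (ρ j) :=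
  (h j hj).1

/-- Projection: the tower clause of a localised trajectory. [cite: Balaban1985UV3, (2) p.256] -/
theorem LocMemTower.isDescentRT {ℰ : LoopAverage G} {M : CplxModel G 𝔄} {j₀ : ℕ} {prm : ℕ → LocClassParams}
    {ρ : (j : ℕ) → GaugeField (F.P j) 0 G → ℝ} (h : LocMemTower F ℰ M j₀ prm ρ) {j : ℕ} (hj : j₀ ≤ j) :
    IsDescentRT F ℰ j (ρ (j + 1)) (ρ j) :=
  (h j hj).2

/-- The sandwich-class reading of a localised trajectory (what the organ presently asks, per height). [cite: Balaban1985UV3, (41)-(47) pp.266-267] -/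
theorem LocMemTower.memAtHeight {ℰ : LoopAverage G} {M : CplxModel G 𝔄} {j₀ : ℕ} {prm : ℕ → LocClassParams}
    {ρ : (j : ℕ) → GaugeField (F.P j) 0 G → ℝ} (h : LocMemTower F ℰ M j₀ prm ρ) {j : ℕ} (hj : j₀ ≤ j) :
    MemAtHeight F ℰ j (prm j).toClassParams (ρ j) :=
  (h.locMemAtHeight hj).memAtHeight

/-- A localised trajectory from `j₀` on is one from any later height on. [cite: Balaban1985UV3, (2) p.256] -/
theorem LocMemTower.mono {ℰ : LoopAverage G} {M : CplxModel G 𝔄} {j₀ j₁ : ℕ} {prm : ℕ → LocClassParams}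
    {ρ : (j : ℕ) → GaugeField (F.P j) 0 G → ℝ} (h : LocMemTower F ℰ M j₀ prm ρ) (hj : j₀ ≤ j₁) : LocMemTower F ℰ M j₁ prm ρ :=
  fun j hj' => h j (hj.trans hj')

/-- A run trajectory gives localised height memberships between `j₀` and the run's depth. [cite: Balaban1985UV3, (2) p.256] -/
theorem LocMemTowerOfRun.locMemAtHeight {ℰ : LoopAverage G} {M : CplxModel G 𝔄} {j₀ K : ℕ} {prm : ℕ → LocClassParams}
    {ρ : (j : ℕ) → GaugeField (F.P j) 0 G → ℝ} (h : LocMemTowerOfRun F ℰ M j₀ K prm ρ) {j : ℕ} (hj₀ : j₀ ≤ j) (hj : j ≤ K) :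
    LocMemAtHeight F ℰ M j (prm j) (ρ j) :=
  (h.1 j hj₀ hj).locMemAtHeight

namespace IsDescentRT

variable {ℰ : LoopAverage G} {j : ℕ} {ρup : GaugeField (F.P (j + 1)) 0 G → ℝ} {ρdn ρdn' : GaugeField (F.P j) 0 G → ℝ}

/-- **TOTAL MASS IS PRESERVED**: `∫ ρdn dU_j = ∫ ρup dU_{j+1}` ([Balaban1985UV3] (6) p.257: the normalization identities of the RT).
[cite: Balaban1985UV3, (6) p.257] -/
theorem integral_eq (h : IsDescentRT F ℰ j ρup ρdn) :
    ∫ V, ρdn V ∂(fieldMeasure (F.P j) 0 G) = ∫ U, ρup U ∂(fieldMeasure (F.P (j + 1)) 0 G) := by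
  simpa using h (fun _ => 1) measurable_const ⟨1, fun _ => by simp⟩

/-- The set form: `∫_{s} ρdn dU_j = ∫_{descend⁻¹ s} ρup dU_{j+1}` for measurable `s` (take `f = 𝟙_s`).
[cite: Balaban1985Averaging, (10) p.19] -/
theorem setIntegral_eq [RegularGaugeGroup G] (hE : ℰ.MeasurableE) (h : IsDescentRT F ℰ j ρup ρdn)
    {s : Set (GaugeField (F.P j) 0 G)} (hs : MeasurableSet s) :
    ∫ V in s, ρdn V ∂(fieldMeasure (F.P j) 0 G) = ∫ U in descend F ℰ j ⁻¹' s, ρup U ∂(fieldMeasure (F.P (j + 1)) 0 G) := by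
  have hD : Measurable (descend F ℰ j) := measurable_descend F ℰ hE j
  have h1 := h (s.indicator fun _ => (1 : ℝ)) (measurable_const.indicator hs)
    ⟨1, fun V => by by_cases hV : V ∈ s <;> simp [hV]⟩
  rw [← integral_indicator hs, ← integral_indicator (hD hs)]
  have e1 : (fun V => s.indicator ρdn V) = fun V => ρdn V * s.indicator (fun _ => (1 : ℝ)) V := by
    funext V; by_cases hV : V ∈ s <;> simp [hV]
  have e2 : (fun U => (descend F ℰ j ⁻¹' s).indicator ρup U) =
      fun U => ρup U * s.indicator (fun _ => (1 : ℝ)) (descend F ℰ j U) := by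
    funext U; by_cases hU : descend F ℰ j U ∈ s
    · simp [hU]
    · simp [hU]
  rw [e1, e2]
  exact h1

/-- **«TWO MEMBERS OVER THE SAME RUN DIFFER ONLY IN THE INITIAL DENSITY»**: the tower clause DETERMINES the lower density almost
everywhere from the upper one — two integrable `ρdn`, `ρdn′` that are both descent transforms of the same `ρup` agree `dU_j`-a.e.
(Radon–Nikodym uniqueness; [Balaban1985UV3] (2) p.256 defines `ρ_{k+1}` FROM `ρ_k`). [cite: Balaban1985UV3, (2) p.256] -/
theorem ae_eq [RegularGaugeGroup G] (hE : ℰ.MeasurableE) (h : IsDescentRT F ℰ j ρup ρdn)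
    (h' : IsDescentRT F ℰ j ρup ρdn') (hi : Integrable ρdn (fieldMeasure (F.P j) 0 G))
    (hi' : Integrable ρdn' (fieldMeasure (F.P j) 0 G)) : ρdn =ᵐ[fieldMeasure (F.P j) 0 G] ρdn' :=
  hi.ae_eq_of_forall_setIntegral_eq ρdn ρdn' hi' fun s hs _ => by
    rw [h.setIntegral_eq hE hs, h'.setIntegral_eq hE hs]

/-- **CONVERSELY, THE TOWER CLAUSE GIVES THE MEASURE IDENTITY** for integrable non-negative measurable densities: `ρup·dU_{j+1}` pushes
forward under `descend F ℰ j` to `ρdn·dU_j` — the organ's consistency pair «μ_j = Measure.map (descend F ℰ j) μ_{j+1}»,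
«μ_j = dU_j.withDensity ρ_j» for the measures WITH these densities. [cite: Balaban1985Averaging, (10) p.19] -/
theorem map_withDensity [RegularGaugeGroup G] (hE : ℰ.MeasurableE) (h : IsDescentRT F ℰ j ρup ρdn)
    (hup0 : ∀ U, 0 ≤ ρup U) (hdn0 : ∀ V, 0 ≤ ρdn V) (hiup : Integrable ρup (fieldMeasure (F.P (j + 1)) 0 G))
    (hidn : Integrable ρdn (fieldMeasure (F.P j) 0 G)) :
    Measure.map (descend F ℰ j) ((fieldMeasure (F.P (j + 1)) 0 G).withDensity fun U => ENNReal.ofReal (ρup U)) =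
      (fieldMeasure (F.P j) 0 G).withDensity fun V => ENNReal.ofReal (ρdn V) := by
  have hD : Measurable (descend F ℰ j) := measurable_descend F ℰ hE j
  ext s hs
  rw [Measure.map_apply hD hs, withDensity_apply _ (hD hs), withDensity_apply _ hs,
    ← ofReal_integral_eq_lintegral_ofReal hiup.restrict (Filter.Eventually.of_forall hup0),
    ← ofReal_integral_eq_lintegral_ofReal hidn.restrict (Filter.Eventually.of_forall hdn0), h.setIntegral_eq hE hs]

end IsDescentRT

/-- **THE ORGAN'S CONSISTENCY PAIR IMPLIES THE TOWER CLAUSE**: if `μup = ρup·dU_{j+1}` pushes forward under `descend F ℰ j` to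
`ρdn·dU_j` (the two hypotheses «μ_j = Measure.map (descend F ℰ j) μ_{j+1}» and «μ_j = dU_j.withDensity ρ_j» of stmt-QuantumFields-27939,
combined), with `ρup`, `ρdn` measurable and non-negative, then `IsDescentRT F ℰ j ρup ρdn`.  (Change of variables `integral_map` and
`∫ g d(μ.withDensity ρ) = ∫ ρ·g dμ`.) [cite: Balaban1985Averaging, (10) p.19] -/
theorem isDescentRT_of_map_withDensity [RegularGaugeGroup G] {ℰ : LoopAverage G} (hE : ℰ.MeasurableE) {j : ℕ}
    {ρup : GaugeField (F.P (j + 1)) 0 G → ℝ} {ρdn : GaugeField (F.P j) 0 G → ℝ}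
    (hup : Measurable ρup) (hdn : Measurable ρdn) (hup0 : ∀ U, 0 ≤ ρup U) (hdn0 : ∀ V, 0 ≤ ρdn V)
    (hmap : Measure.map (descend F ℰ j) ((fieldMeasure (F.P (j + 1)) 0 G).withDensity fun U => ENNReal.ofReal (ρup U)) =
      (fieldMeasure (F.P j) 0 G).withDensity fun V => ENNReal.ofReal (ρdn V)) :
    IsDescentRT F ℰ j ρup ρdn := by
  intro f hf _
  have hD : Measurable (descend F ℰ j) := measurable_descend F ℰ hE j
  have edn : ∫ V, ρdn V * f V ∂(fieldMeasure (F.P j) 0 G) =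
      ∫ V, f V ∂(fieldMeasure (F.P j) 0 G).withDensity fun V => ENNReal.ofReal (ρdn V) := by
    rw [integral_withDensity_eq_integral_toReal_smul hdn.ennreal_ofReal
      (Filter.Eventually.of_forall fun _ => ENNReal.ofReal_lt_top)]
    exact integral_congr_ae (Filter.Eventually.of_forall fun V => by
      simp [ENNReal.toReal_ofReal (hdn0 V), smul_eq_mul])
  have eup : ∫ U, ρup U * f (descend F ℰ j U) ∂(fieldMeasure (F.P (j + 1)) 0 G) =
      ∫ U, f (descend F ℰ j U) ∂(fieldMeasure (F.P (j + 1)) 0 G).withDensity fun U => ENNReal.ofReal (ρup U) := by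
    rw [integral_withDensity_eq_integral_toReal_smul hup.ennreal_ofReal
      (Filter.Eventually.of_forall fun _ => ENNReal.ofReal_lt_top)]
    exact integral_congr_ae (Filter.Eventually.of_forall fun U => by
      simp [ENNReal.toReal_ofReal (hup0 U), smul_eq_mul])
  rw [edn, eup, ← hmap, integral_map hD.aemeasurable hf.aestronglyMeasurable]

/-! ### §3b The small-field renormalization step (0.19) between consecutive effective actions, as a separate tower schema -/

variable (F)

/-- **THE SMALL-FIELD RENORMALIZATION STEP (0.19) BETWEEN CONSECUTIVE EFFECTIVE ACTIONS**, in the push-forward reading and on the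
windows: there is a normalisation `N > 0` such that, tested against every bounded measurable `f` SUPPORTED IN THE LOWER WINDOW
`{PlaqSmall δdn}`, `∫ e^{effdn}·f dU_j = N·∫ χ_{δup}·e^{effup}·(f ∘ descend) dU_{j+1}` — i.e. on the window `exp(effdn(V)) = N·∫_{fibre(V)}
χ_{j+1}(U) exp(effup(U)) dσ_V(U)` ([Balaban1987RG1] (0.19) p.255 «exp A_{k+1}(V) = N_k⁻¹ ∫ dU δ(ŪV⁻¹) … χ_k exp[−(1/g_k²)G(…) + A_k(U)] … where
the constant N_k is given by the integral above with V = 1», p.256 «The characteristic function χ_k restricts the integral to small fluctuation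
fields»; [Balaban1985UV3] (49)–(51) p.268, the δ-function form).  READINGS: the gauge-fixing weight `e^{−G/g_k²}` of (0.17)/(0.19) is omitted —
for gauge-invariant integrands it changes only the normalisation (p.255 «the integrand does not depend on u and the integral over u is equal
to 1»); print's `χ_k` restricts the FLUCTUATION variables, here it is the all-small plaquette window `chiSmall univ δup` of the upper height.
[cite: Balaban1987RG1, (0.19) pp.255-256; Balaban1985UV3, (49)-(51) p.268] -/
def IsSmallFieldRT (ℰ : LoopAverage G) (j : ℕ) (δup δdn : ℝ) (effup : GaugeField (F.P (j + 1)) 0 G → ℝ)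
    (effdn : GaugeField (F.P j) 0 G → ℝ) : Prop :=
  ∃ N : ℝ, 0 < N ∧ ∀ f : GaugeField (F.P j) 0 G → ℝ, Measurable f → (∃ C : ℝ, ∀ V, |f V| ≤ C) →
    (∀ V, ¬ PlaqSmall δdn V → f V = 0) →
      ∫ V, Real.exp (effdn V) * f V ∂(fieldMeasure (F.P j) 0 G) =
        N * ∫ U, chiSmall Set.univ δup U * Real.exp (effup U) * f (descend F ℰ j U) ∂(fieldMeasure (F.P (j + 1)) 0 G)

/-- **LOCALISED CLASS TRAJECTORY WITH THE SMALL-FIELD STEP** (from height `j₀` on): a family of EFFECTIVE ACTIONS `eff j` on the height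
lattices such that, for every `j ≥ j₀`, `eff j` IS the effective action `−β·A(bg V) + Σ_X act X (bg V) + cst` of a localised witness of `ρ j`
(read at height `j`), the tower clause `IsDescentRT` holds for the densities, AND consecutive effective actions are related by the
small-field step (0.19) on the windows (`IsSmallFieldRT`).  Requested by the planner as a SEPARATE name so that a route may state R1 with or
without (0.19). [cite: Balaban1987RG1, (0.19) pp.255-256, (0.22)-(0.25) pp.256-257; Balaban1985UV3, (2) p.256] -/
def LocMemTowerSF (ℰ : LoopAverage G) (M : CplxModel G 𝔄) (j₀ : ℕ) (prm : ℕ → LocClassParams)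
    (ρ : (j : ℕ) → GaugeField (F.P j) 0 G → ℝ) : Prop :=
  ∃ eff : (j : ℕ) → GaugeField (F.P j) 0 G → ℝ, ∀ j, j₀ ≤ j →
    (∃ K : ℕ, ∃ hK : j ≤ K,
      ∃ W : LocWitness (fun i => BlockAveraging.blockAvg (P := F.P K) (j := i) ℰ) (prm j) M (readAtLevel F hK (ρ j)),
        ∀ V, eff j V = W.eff (fieldShift (heightShift_eq F hK).symm V)) ∧
    IsDescentRT F ℰ j (ρ (j + 1)) (ρ j) ∧
    IsSmallFieldRT F ℰ j (prm (j + 1)).δ (prm j).δ (eff (j + 1)) (eff j)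

variable {F}

/-- A trajectory with the small-field step is a localised trajectory. [cite: Balaban1987RG1, (0.19) pp.255-256] -/
theorem LocMemTowerSF.locMemTower {ℰ : LoopAverage G} {M : CplxModel G 𝔄} {j₀ : ℕ} {prm : ℕ → LocClassParams}
    {ρ : (j : ℕ) → GaugeField (F.P j) 0 G → ℝ} (h : LocMemTowerSF F ℰ M j₀ prm ρ) : LocMemTower F ℰ M j₀ prm ρ := by
  obtain ⟨eff, h⟩ := h
  intro j hj
  obtain ⟨⟨K, hK, W, _⟩, hRT, _⟩ := h j hj
  exact ⟨⟨K, hK, ⟨W⟩⟩, hRT⟩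

omit [MeasurableSpace G] [HaarData G] in
/-- Windows are invariant under the level identification (plaquettes correspond, `T3LevelShift.plaqHol_fieldShift`). [cite: Balaban1985UV3, (1)-(3) p.256] -/
private theorem plaqSmall_fieldShift_iff {m K j m' K' j' : ℕ} (h : (F.PP m K).sitesPerDir j = (F.PP m' K').sitesPerDir j')
    (δ : ℝ) (V : GaugeField (F.PP m' K') j' G) : PlaqSmall δ (fieldShift h V) ↔ PlaqSmall δ V := by
  unfold PlaqSmall
  simp_rw [plaqHol_fieldShift h V]
  exact (plaqShift h).forall_congr_right (q := fun q => dist1 (GaugeField.plaqHol V q) < δ)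

/-- **THE EFFECTIVE ACTIONS OF A TRAJECTORY WITH THE SMALL-FIELD STEP**: a family `eff` with, at every height `j ≥ j₀`, `exp(eff j V) ≤ ρ j V`
on the window (the exact representation of the witness read at height `j`; equality up to the suppressed large-field part) and the
small-field step (0.19) between `eff (j+1)` and `eff j`. [cite: Balaban1987RG1, (0.19) pp.255-256, (0.22) p.256] -/
theorem LocMemTowerSF.exists_eff {ℰ : LoopAverage G} {M : CplxModel G 𝔄} {j₀ : ℕ} {prm : ℕ → LocClassParams}
    {ρ : (j : ℕ) → GaugeField (F.P j) 0 G → ℝ} (h : LocMemTowerSF F ℰ M j₀ prm ρ) :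
    ∃ eff : (j : ℕ) → GaugeField (F.P j) 0 G → ℝ, ∀ j, j₀ ≤ j →
      (∀ V, PlaqSmall (prm j).δ V → Real.exp (eff j V) ≤ ρ j V) ∧
      IsSmallFieldRT F ℰ j (prm (j + 1)).δ (prm j).δ (eff (j + 1)) (eff j) := by
  obtain ⟨eff, h⟩ := h
  refine ⟨eff, fun j hj => ?_⟩
  obtain ⟨⟨K, hK, W, hW⟩, _, hSF⟩ := h j hj
  refine ⟨fun V hV => ?_, hSF⟩
  rw [hW V, ← readAtLevel_fieldShift_symm F hK (ρ j) V]
  exact W.exp_eff_le _ ((plaqSmall_fieldShift_iff _ _ V).mpr hV)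

end Height

/-! ## §4 The complex model of `SU(n)` -/

section SpecialUnitary

open Literature.MathematicalPhysics.QuantumLattice
open scoped Matrix.Norms.L2Operator

/-- **`SU(n) ⊂ M_n(ℂ)` AS A COMPLEX MODEL**: the fundamental representation of the tree (`fundamentalRep`, the inclusion), `M_n(ℂ)` with the
L²-OPERATOR norm (Mathlib scope `Matrix.Norms.L2Operator`, the norm of `UnitaryModel`: `dist1 U = ‖U − 1‖` holds by `rfl`), faithful,
unitaries of norm `≤ 1` ([Balaban1985Averaging] p.20 «G is a Lie subgroup of U(N)», (19) p.21). [cite: Balaban1985Averaging, (19) p.21] -/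
def CplxModel.specialUnitary (n : Type*) [Fintype n] [DecidableEq n] [Nonempty n] :
    CplxModel (Matrix.specialUnitaryGroup n ℂ) (Matrix n n ℂ) where
  ι := fundamentalRep n
  injective := fundamentalRep_injective n
  norm_sub_one _ := rfl
  norm_le_one U := by
    rcases subsingleton_or_nontrivial (Matrix n n ℂ) with h | h
    · simp [Subsingleton.elim (fundamentalRep n U) 0]
    · exact (CStarRing.norm_coe_unitary ⟨(U : Matrix n n ℂ), fundamentalRep_mem_unitaryGroup U⟩).le

end SpecialUnitary

end Literature.MathematicalPhysics.QuantumFieldTheory.Balaban1983to89.BalabanUVClass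

namespace Literature.MathematicalPhysics.QuantumFieldTheory.Balaban1983to89

/-- **Alias under the work item's notion name** (`defn-BalabanLocalisedClass`): `BalabanLocalisedClass av prm M r` IS
`BalabanUVClass.LocMem av prm M r`. [cite: Balaban1987RG1, (0.22)-(0.25) pp.256-257, (1.18) p.263; Balaban1985Variational, Prop. 9 p.309] -/
abbrev BalabanLocalisedClass {P : Params} {k : ℕ} {G : Type*} [GaugeGroup G] [MeasurableSpace G] {𝔄 : Type*} {_ : NormedRing 𝔄}
    {_ : NormedAlgebra ℂ 𝔄} (av : (i : ℕ) → Averaging P i G) (prm : BalabanUVClass.LocClassParams) (M : BalabanUVClass.CplxModel G 𝔄)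
    (r : GaugeField P k G → ℝ) : Prop :=
  BalabanUVClass.LocMem av prm M r

end Literature.MathematicalPhysics.QuantumFieldTheory.Balaban1983to89

end
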